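import Literature.NumberTheory.LFunctions.WeilMarkovQuadratic
import Literature.NumberTheory.LFunctions.WeilGroundStateRealZerosProofs
import HarnessLib

set_option linter.dupNamespace false

/-!
# `L²`-continuity of Weil's pole form on a window
# (origin-layer line of `OddSector.OddOneSignedWindows`)

Stub `stub_tendsto_weilPoleForm` of the line `Sketch` of crux item stmt-RiemannHypothesis-17778
(RH-free, pure `L²` bookkeeping; normalisation of
`Literature/NumberTheory/LFunctions/WeilMarkovQuadratic.lean`:
`P(g) = weilPoleForm g = 2 |∫ g(t) cosh(t/2) dt|² − 2 |∫ g(t) sinh(t/2) dt|²`).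

If `gₙ → u` in `L²(ℝ)` and all of `gₙ`, `u` vanish a.e. off the window `[-a, a]`, then
`P(gₙ) → P(u)`. The weights `cosh(t/2)`, `sinh(t/2)` are unbounded on `ℝ` but bounded on the
window, so `∫ gₙ(t) cosh(t/2) dt = ∫ gₙ(t) conj(1_{[-a,a]}(t) cosh(t/2)) dt` (a.e. congruence) with
`1_{[-a,a]} cosh(·/2) ∈ L²`, and the pairing with a fixed `L²` function is continuous along
`L²`-convergent sequences (Cauchy–Schwarz,
`ConnesVanSuijlekom.tendsto_integral_mul_conj_left`); same for `sinh`; finally `z ↦ 2‖z‖²` is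
continuous. No case split on the sign of `a` is needed.

No definitions are introduced into the tree.
-/

noncomputable section

open Complex Filter Set MeasureTheory
open scoped Real Topology ComplexConjugate ENNReal

namespace Summit.RiemannHypothesis.RiemannHypothesis.Theorems.OddSector

open Literature.NumberTheory.LFunctions Literature.NumberTheory.LFunctions.ConnesVanSuijlekom

/-- Pairings with a continuous real weight converge along an `L²`-convergent sequence of functions
vanishing a.e. off a fixed window `[-R, R]`. [folklore] -/
theorem tendsto_integral_mul_ofReal_of_ae_window {R : ℝ} {f : ℝ → ℂ} {g : ℕ → ℝ → ℂ}
    (hf : MemLp f 2) (hg : ∀ n, MemLp (g n) 2) (hfR : ∀ᵐ x : ℝ, x ∉ Icc (-R) R → f x = 0)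
    (hgR : ∀ n, ∀ᵐ x : ℝ, x ∉ Icc (-R) R → g n x = 0)
    (hlim : Tendsto (fun n ↦ ∫ x, ‖g n x - f x‖ ^ 2) atTop (𝓝 0)) {w : ℝ → ℝ}
    (hw : Continuous w) :
    Tendsto (fun n ↦ ∫ x, g n x * (w x : ℂ)) atTop (𝓝 (∫ x, f x * (w x : ℂ))) := by
  -- adapted from `tendsto_integral_mul_ofReal_of_window`
  -- (Theorems/OddSectorOddOneSignedWindowsFormDomainTools.lean: pointwise-vanishing version)
  set u : ℝ → ℂ := (Icc (-R) R).indicator fun x ↦ ((w x : ℝ) : ℂ) with hu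
  have hwc : Continuous fun x : ℝ ↦ ((w x : ℝ) : ℂ) := Complex.continuous_ofReal.comp hw
  obtain ⟨C, hC⟩ := (isCompact_Icc (a := -R) (b := R)).exists_bound_of_continuousOn
    hwc.continuousOn
  have hum : MemLp u 2 volume := by
    rw [hu, memLp_indicator_iff_restrict measurableSet_Icc]
    exact MemLp.of_bound hwc.aestronglyMeasurable C
      ((ae_restrict_iff' measurableSet_Icc).2 (Eventually.of_forall hC))
  have key : ∀ v : ℝ → ℂ, (∀ᵐ x : ℝ, x ∉ Icc (-R) R → v x = 0) →
      ∫ x, v x * (w x : ℂ) = ∫ x, v x * conj (u x) := by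
    intro v hv
    refine integral_congr_ae (hv.mono fun x hx ↦ ?_)
    show v x * (w x : ℂ) = v x * conj (u x)
    by_cases hxR : x ∈ Icc (-R) R
    · rw [hu, indicator_of_mem hxR, Complex.conj_ofReal]
    · rw [hx hxR, zero_mul, zero_mul]
  have hgk : (fun n ↦ ∫ x, g n x * (w x : ℂ)) = fun n ↦ ∫ x, g n x * conj (u x) :=
    funext fun n ↦ key (g n) (hgR n)
  rw [hgk, key f hfR]
  exact tendsto_integral_mul_conj_left hum hf hg hlim

/-- **`L²`-continuity of the pole form on a window (RH-free).** If `gₙ → u` in `L²` and all of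
`gₙ, u` vanish a.e. off `[-a, a]`, then `P(gₙ) → P(u)` (`P = weilPoleForm`; the weights
`cosh(t/2), sinh(t/2)` are bounded on the window). [folklore] -/
theorem stub_tendsto_weilPoleForm :
    ∀ (a : ℝ) (u : ℝ → ℂ) (g : ℕ → ℝ → ℂ), MemLp u 2 volume → (∀ n, MemLp (g n) 2 volume) →
      (∀ᵐ t : ℝ, t ∉ Icc (-a) a → u t = 0) → (∀ n, ∀ᵐ t : ℝ, t ∉ Icc (-a) a → g n t = 0) →
      Tendsto (fun n ↦ ∫ t, ‖g n t - u t‖ ^ 2) atTop (𝓝 0) →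
      Tendsto (fun n ↦ weilPoleForm (g n)) atTop (𝓝 (weilPoleForm u)) := by
  intro a u g hu hg hua hga hlim
  have hc := tendsto_integral_mul_ofReal_of_ae_window hu hg hua hga hlim
    (w := fun x ↦ Real.cosh (x / 2)) (by fun_prop)
  have hs := tendsto_integral_mul_ofReal_of_ae_window hu hg hua hga hlim
    (w := fun x ↦ Real.sinh (x / 2)) (by fun_prop)
  unfold weilPoleForm
  exact ((hc.norm.pow 2).const_mul 2).sub ((hs.norm.pow 2).const_mul 2)

end Summit.RiemannHypothesis.RiemannHypothesis.Theorems.OddSector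

end
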